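import Literature.Computability.AlgebraicComplexity.LMR13ZariskiTangentDivisibility
import Literature.Computability.AlgebraicComplexity.LMR13PaddingLemmaNotMem
import Literature.Computability.AlgebraicComplexity.DeterminantIrreducible
import Literature.Computability.AlgebraicComplexity.MR04HessianExactRank
import HarnessLib

/-!
# LMR 2013 §3.3: (Zarb) and Lemma 3.3.2 — the first-order identity at a root along a kernel
# vector of the Hessian, and its specialisation to `det_n`

Cell val-lit (D-0074), row LMR13-A; lead-lmr g3 ladder (FINAL SPLIT 2026-08-26T14:05Z), step after
the rungs (Z0) (`LMR13FirstOrderIdentity.lean`, val-lit-t17) and (Z1)/(Z2)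
(`LMR13ZariskiTangentDivisibility.lean`, val-lit-p7): the identity (Zarb) and Lemma 3.3.2 of
Landsberg–Manivel–Ressayre 2013, §3.3 (journal pp. 477–478 = arXiv:1004.4802 `p0006.txt:L68–100`,
`p0007.txt:L18–25`), the input of §3.4 (Lemma 3.4.1, Prop. 3.4.2, Thm. 3.1.1).

LMR §3.3: "To exploit (Zar), let `[w]` be a general point of the hypersurface `Z(P)`, so the rank of
the quadratic form `H_{P,w}` is exactly `k+2`. Let `X` belong to the kernel of `H_{P,w}`. Let `F′`
be a `(k+2)`-dimensional subspace of `W`, transverse to the kernel of `H_{P,w}`, and let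
`F = F′ ⊕ ℂX`. … Equation (Zar) becomes (Zarb) `det(H_{P,w}|_{F′}) H_{π,w}(X) = π(w) Q_F(w)`." and
Lemma 3.3.2: "Suppose that `π ∈ S^nW^*` belongs to the affine Zariski tangent space
`T̂_{[det_n]} 𝒟ual_{2n−2,n,n²}`. Then for any matrix `w` of rank `n−1`, and any
`X ∈ (H_{det_n,w})_{sing}`, `H_{π,w}(X) = c_{X,w} π(w)`, for some scalar `c_{X,w}` that does not
depend on `π`."

## What is proved (theorems only; no definition, no named fact)

* `coeff_one_det_map_C_add_X_smul` — `[ε¹] det(M + εN) = det(M′)·N_{last,last}` for square `M, N`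
  with `M` having zero last row and column (`M′` the upper-left block): the determinant expansion
  of the printed proof (`p0006.txt:L80–88`).
* `hessianMatrix_firstOrderDeformation_C_comp` (`H_{P+επ} = H_P + εH_π` at a point with constant
  coordinates), `eval_C_comp_hessGenMinor_firstOrderDeformation`
  (`det(B·H_{P+επ}·Bᵀ)(w) = det(M + εN)`, `M = B·H_P(w)·Bᵀ`, `N = B·H_π(w)·Bᵀ`).
* `det_mul_hessianQuadratic_eq_of_mem_lmrZariskiTangent` — **(Zarb)** in tree language: `P` prime
  of degree `d ≥ 3`, `π ∈ lmrZariskiTangent k d P`, a `(k+3)`-frame `B` whose last row `X` is in the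
  kernel of `H_P(w)` at a root `w` of `P`, `det(B·H_P·Bᵀ) = P·Q` ⟹
  `det(B′·H_P(w)·B′ᵀ) · (Xᵀ·H_π(w)·X) = π(w)·Q(w)`, `B′` = the first `k+2` rows. It holds at EVERY
  root `w` and for every `F′` (genericity and transversality only serve to make
  `det(B′·H_P(w)·B′ᵀ) ≠ 0`); `hessianQuadratic_eq_zero_of_mem_lmrZariskiTangent` is the vanishing
  form (`π(w) = 0`, `det(B′H_P(w)B′ᵀ) ≠ 0` ⟹ `Xᵀ H_π(w) X = 0`).
* `exists_hessianQuadratic_eq_mul_eval_of_mem_lmrZariskiTangent_detPoly` — **Lemma 3.3.2** for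
  `n ≥ 3`: for `rank Y = n − 1` and `X` in the kernel of the Hessian matrix of `det_n` at `Y` (the
  space LMR Lemma 3.3.1 describes — `hessianMatrix_detPoly_mulVec_eq_zero_iff_of_rank`,
  `LMR13DetHessianKernel.lean`, val-lit-t10), there is `c` (depending on `Y, X` only) with
  `Xᵀ·H_π(Y)·X = c·π(Y)` for every `π ∈ T̂_{[det_n]} 𝒟ual_{2n−2,n,n²}`; and the vanishing form
  `hessianQuadratic_eq_zero_of_mem_lmrZariskiTangent_detPoly` (`π(Y) = 0 ⟹ Xᵀ·H_π(Y)·X = 0`), which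
  is what §3.4 uses ("the vanishing of `IM_λ(w′,μ)` implies the vanishing of `IM_λ(ζ,w′,μ)`",
  `p0007.txt:L96–98`).

## Proofs

(Zarb): evaluate (Z1) `P ∣ D_π(B) − π·Q` at the root `w` (so `D_π(B)(w) = π(w)Q(w)`) and compute
`D_π(B)(w) = [ε¹] det(B·H_{P+επ}·Bᵀ)(w) = [ε¹] det(M + εN)` with `M = B·H_P(w)·Bᵀ` having zero
last row and column because `H_P(w)X = 0` and `H_P(w)` is symmetric; pulling `ε` out of the last row
of `M + εN`, setting `ε = 0` and expanding along the last column gives `det(M′)·N_{last,last}` with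
`N_{last,last} = Xᵀ·H_π(w)·X`. Lemma 3.3.2: `rank H_{det_n,Y} = 2n` at a corank-one `Y`
(`rank_hessianMatrix_detPoly_eq_two_mul_card`, `MR04HessianExactRank.lean`, val-lit-t10), so a
`2n`-frame `B′` with `det(B′·H·B′ᵀ) ≠ 0` exists (`PaddingNotMem.exists_frame_det_ne_zero_of_le_rank`,
val-lit-t12); `det_n` is prime (`detPoly_prime`) and lies in `𝒟ual_{2n−2,n,n²}`
(`detPoly_mem_lmrDualScheme`), so (Z0) (`dvd_hessGenMinor_of_prime_of_mem_lmrDualScheme`) gives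
`det(B·H_{det}·Bᵀ) = det_n · Q` for `B = (B′; X)`, and (Zarb) yields `c_{X,Y} = Q(Y)/det(B′·H·B′ᵀ)`.

Honest framing: infrastructure of the LMR13-A ladder toward Prop. 3.4.2 ⇒ / Thm. 3.1.1 ⊆; VP ≠ VNP is
NOT proved and nothing here is progress on it.

## References

* J. M. Landsberg, L. Manivel, N. Ressayre, *Hypersurfaces with degenerate duals and the geometric
  complexity theory program*, Comment. Math. Helv. 88 (2013) 469–484, §3.3 eq. (Zarb) (p. 477),
  Lemma 3.3.2 (p. 478); arXiv:1004.4802, `p0006.txt:L68–100`, `p0007.txt:L18–25`.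
  [cite: LandsbergManivelRessayre2013, §3.3 (pp. 477–478)]

## Tree

`dvd_firstOrder_of_mem_lmrZariskiTangent`, `epsCoeff`, `coeff_one_eval_C_comp`,
`pderiv_firstOrderDeformation`, `eval_C_comp_firstOrderDeformation` (`LMR13ZariskiTangentDivisibility`);
`dvd_hessGenMinor_of_prime_of_mem_lmrDualScheme` (`LMR13FirstOrderIdentity`);
`detPoly_mem_lmrDualScheme` (`LMR13DualSchemeDetProofs`); `detPoly_prime` (`DeterminantIrreducible`);
`rank_hessianMatrix_detPoly_eq_two_mul_card` (`MR04HessianExactRank`);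
`PaddingNotMem.exists_frame_det_ne_zero_of_le_rank` (`LMR13PaddingLemmaNotMem`); `hessianMatrix`,
`hessianMatrix_transpose` (`HessianRank`); `eval_hessGenMinor` (`BorderDcQuadraticBoundProofs`);
`eval_detPoly`, `detPoly_isHomogeneous` (`StandardFamilies`). Mathlib: `Matrix.det_updateRow_smul`,
`Matrix.det_succ_column`, `Matrix.submatrix_updateRow_succAbove`, `RingHom.map_det`, `Fin.snoc`.
-/

noncomputable section

open MvPolynomial Matrix

namespace Literature.Computability.AlgebraicComplexity

/-! ### The `ε¹`-coefficient of `det(M + εN)` when `M` has a zero last row and column -/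

section DetFirstOrder

variable {R : Type*} [CommRing R]

/-- `(ε · g)₁ = g₀`. [folklore] -/
private theorem coeff_one_X_mul' (g : Polynomial R) : (Polynomial.X * g).coeff 1 = g.coeff 0 :=
  Polynomial.coeff_X_mul g 0

omit [CommRing R] in
/-- Updating the same row twice keeps the last update. [folklore] -/
private theorem updateRow_updateRow {m n : Type*} [DecidableEq m] (A : Matrix m n R) (i : m)
    (b c : n → R) : (A.updateRow i b).updateRow i c = A.updateRow i c := by
  ext r s
  simp only [Matrix.updateRow_apply]
  split_ifs <;> rfl

/-- **`[ε¹] det(M + εN) = det(M′) · N_{last,last}` when the last row and the last column of `M`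
vanish** (`M′` = the upper-left block): "the sum of the `k+3` determinants obtained by … replacing one
column by the corresponding column of `H_{π,w}|_F`. If this column is not the last one, this
determinant remains with a zero column … In case the replaced column is the last one, since the last
row … vanishes, the resulting determinant is equal to the determinant of the upper-left block …
multiplied by the lower-right entry" (LMR 2013 §3.3, arXiv `p0006.txt:L80–88`, journal p. 477). Here:
pull `ε` out of the last row, set `ε = 0`, and expand along the last column.
[cite: LandsbergManivelRessayre2013, §3.3 (p. 477)] -/
theorem coeff_one_det_map_C_add_X_smul {m : ℕ} (M N : Matrix (Fin (m + 1)) (Fin (m + 1)) R)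
    (hrow : ∀ j, M (Fin.last m) j = 0) (hcol : ∀ i, M i (Fin.last m) = 0) :
    (M.map Polynomial.C + (Polynomial.X : Polynomial R) • N.map Polynomial.C).det.coeff 1 =
      (M.submatrix Fin.castSucc Fin.castSucc).det * N (Fin.last m) (Fin.last m) := by
  classical
  set A := M.map Polynomial.C + (Polynomial.X : Polynomial R) • N.map Polynomial.C with hA
  set r : Fin (m + 1) → Polynomial R := fun j => Polynomial.C (N (Fin.last m) j) with hr
  -- the last row of `A` is `ε · r`
  have hlast : A (Fin.last m) = (Polynomial.X : Polynomial R) • r := by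
    funext j
    simp only [hA, hr, Matrix.add_apply, Matrix.smul_apply, Matrix.map_apply, hrow j, map_zero,
      zero_add, Pi.smul_apply]
  have hAeq : A = (A.updateRow (Fin.last m) r).updateRow (Fin.last m)
      ((Polynomial.X : Polynomial R) • r) := by
    rw [updateRow_updateRow, ← hlast, Matrix.updateRow_eq_self]
  -- `det A = ε · det A₁`, `A₁ = A` with last row `r`
  have hdet : A.det = Polynomial.X * (A.updateRow (Fin.last m) r).det := by
    conv_lhs => rw [hAeq]
    rw [Matrix.det_updateRow_smul, updateRow_updateRow]
  -- at `ε = 0`, `A₁` becomes `M` with last row `N_{last}`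
  have hA₁ : (A.updateRow (Fin.last m) r).map (Polynomial.eval 0) =
      M.updateRow (Fin.last m) (N (Fin.last m)) := by
    ext i j
    rw [Matrix.map_apply, Matrix.updateRow_apply, Matrix.updateRow_apply]
    split_ifs with h
    · rw [hr, Polynomial.eval_C]
    · simp only [hA, Matrix.add_apply, Matrix.smul_apply, Matrix.map_apply, smul_eq_mul,
        Polynomial.eval_add, Polynomial.eval_C, Polynomial.eval_mul, Polynomial.eval_X, zero_mul,
        add_zero]
  rw [hdet, coeff_one_X_mul', Polynomial.coeff_zero_eq_eval_zero, ← Polynomial.coe_evalRingHom,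
    RingHom.map_det, RingHom.mapMatrix_apply, Polynomial.coe_evalRingHom, hA₁,
    Matrix.det_succ_column _ (Fin.last m), Finset.sum_eq_single (Fin.last m)]
  · rw [Matrix.updateRow_self, Matrix.submatrix_updateRow_succAbove, Fin.succAbove_last,
      (show Even ((Fin.last m : ℕ) + (Fin.last m : ℕ)) from ⟨_, rfl⟩).neg_one_pow, one_mul,
      mul_comm]
  · intro i _ hi
    rw [Matrix.updateRow_ne hi, hcol i, mul_zero, zero_mul]
  · intro h
    exact absurd (Finset.mem_univ _) h

end DetFirstOrder

/-! ### The Hessian of the deformation and the value of the deformed minor at a point -/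

section DeformedMinor

variable {σ : Type*} [Fintype σ]

omit [Fintype σ] in
/-- **`H_{P+επ}(C w) = H_P(w) + ε H_π(w)`** ("Up to `O(ε²)`, `H_P` becomes `H_P + εH_π`", LMR 2013
§3.3, arXiv `p0006.txt:L62`). [cite: LandsbergManivelRessayre2013, §3.3 (p. 477)] -/
theorem hessianMatrix_firstOrderDeformation_C_comp (P π : MvPolynomial σ ℂ) (w : σ → ℂ) :
    hessianMatrix (firstOrderDeformation P π) (fun i => Polynomial.C (w i)) =
      (hessianMatrix P w).map Polynomial.C +
        (Polynomial.X : Polynomial ℂ) • (hessianMatrix π w).map Polynomial.C := by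
  ext u v
  simp only [hessianMatrix_apply, pderiv_firstOrderDeformation, eval_C_comp_firstOrderDeformation,
    Matrix.add_apply, Matrix.smul_apply, Matrix.map_apply, smul_eq_mul]

/-- Entries of `B · H · Bᵀ`: `(B H Bᵀ)_{ij} = B_i · (H B_j)`. [folklore] -/
private theorem mul_mul_transpose_apply {ρ : Type*} {R : Type*} [CommRing R] (B : Matrix ρ σ R)
    (H : Matrix σ σ R) (i j : ρ) : (B * H * Bᵀ) i j = B i ⬝ᵥ (H *ᵥ B j) := by
  simp only [Matrix.mul_apply, Matrix.transpose_apply, dotProduct, Matrix.mulVec, Finset.sum_mul,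
    Finset.mul_sum]
  rw [Finset.sum_comm]
  refine Finset.sum_congr rfl fun a _ => Finset.sum_congr rfl fun b _ => ?_
  ring

/-- **The deformed minor at a point**: `det(B · H_{P+επ} · Bᵀ)(C w) = det(M + εN)` with
`M = B·H_P(w)·Bᵀ`, `N = B·H_π(w)·Bᵀ`. [cite: LandsbergManivelRessayre2013, §3.3 (p. 477)] -/
theorem eval_C_comp_hessGenMinor_firstOrderDeformation {r : ℕ} (B : Matrix (Fin r) σ ℂ)
    (P π : MvPolynomial σ ℂ) (w : σ → ℂ) :
    eval (fun i => Polynomial.C (w i))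
        (hessGenMinor (B.map (Polynomial.C : ℂ →+* Polynomial ℂ))
          (B.map (Polynomial.C : ℂ →+* Polynomial ℂ)) (firstOrderDeformation P π)) =
      ((B * hessianMatrix P w * Bᵀ).map Polynomial.C +
        (Polynomial.X : Polynomial ℂ) • (B * hessianMatrix π w * Bᵀ).map Polynomial.C).det := by
  rw [eval_hessGenMinor, hessianMatrix_firstOrderDeformation_C_comp]
  congr 1
  rw [Matrix.mul_add, Matrix.add_mul, Matrix.mul_smul, Matrix.smul_mul, Matrix.map_mul,
    Matrix.map_mul, Matrix.map_mul, Matrix.map_mul, Matrix.transpose_map]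

end DeformedMinor

/-! ### (Zarb): (Zar) at a root along a kernel vector of the Hessian -/

section Zarb

variable {σ : Type*} [Fintype σ]

/-- **(Zarb)** (LMR 2013 §3.3, arXiv `p0006.txt:L68–100`, journal p. 477: "let `[w]` be a … point
of the hypersurface `Z(P)` … Let `X` belong to the kernel of `H_{P,w}`. Let `F′` be a
`(k+2)`-dimensional subspace of `W` … and let `F = F′ ⊕ ℂX` … Equation (Zar) becomes
`det(H_{P,w}|_{F′}) H_{π,w}(X) = π(w) Q_F(w)`"): for a PRIME form `P` of degree `d ≥ 3`, a Zariski
tangent vector `π ∈ T̂_{[P]} 𝒟ual_{k,d,N}`, a frame `B` of `k + 3` rows whose LAST row `X` lies in the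
kernel of the Hessian matrix `H_P(w)` at a root `w` of `P` (the first `k + 2` rows span `F′`), and
`det(B·H_P·Bᵀ) = P·Q`:
`det(B′·H_P(w)·B′ᵀ) · (Xᵀ H_π(w) X) = π(w) · Q(w)`. (No genericity of `w` or transversality of
`F′` is needed for the identity; they only make `det(B′·H_P(w)·B′ᵀ) ≠ 0`.) Proof: evaluate (Z1)
(`dvd_firstOrder_of_mem_lmrZariskiTangent`) at `w` and compute `D_π(B)(w) = [ε¹]det(M + εN)` by
`coeff_one_det_map_C_add_X_smul`. [cite: LandsbergManivelRessayre2013, §3.3 eq. (Zarb) (p. 477)] -/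
theorem det_mul_hessianQuadratic_eq_of_mem_lmrZariskiTangent {κ d : ℕ} (hd : 3 ≤ d)
    {P π Q : MvPolynomial σ ℂ} (hprime : Prime P) (hP : P.IsHomogeneous d)
    (hπ : π ∈ lmrZariskiTangent κ d P) (B : Matrix (Fin (κ + 3)) σ ℂ)
    (hQ : hessGenMinor B B P = P * Q) {w : σ → ℂ} (hw : eval w P = 0)
    (hX : hessianMatrix P w *ᵥ B (Fin.last (κ + 2)) = 0) :
    (B.submatrix Fin.castSucc id * hessianMatrix P w * (B.submatrix Fin.castSucc id)ᵀ).det *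
        (B (Fin.last (κ + 2)) ⬝ᵥ (hessianMatrix π w *ᵥ B (Fin.last (κ + 2)))) =
      eval w π * eval w Q := by
  classical
  obtain ⟨R, hR⟩ := dvd_firstOrder_of_mem_lmrZariskiTangent hd hprime hP B hQ hπ
  -- evaluate (Z1) at the root `w`
  have hDw : eval w (epsCoeff 1 (hessGenMinor (B.map (Polynomial.C : ℂ →+* Polynomial ℂ))
      (B.map (Polynomial.C : ℂ →+* Polynomial ℂ)) (firstOrderDeformation P π))) =
      eval w π * eval w Q := by
    have h := congrArg (eval w) hR
    rw [map_sub, map_mul, map_mul, hw, zero_mul, sub_eq_zero] at h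
    exact h
  -- and compute the left-hand side as `[ε¹] det(M + εN)`
  set M := B * hessianMatrix P w * Bᵀ with hM
  set N := B * hessianMatrix π w * Bᵀ with hN
  have hrow : ∀ j, M (Fin.last (κ + 2)) j = 0 := fun j => by
    rw [hM, mul_mul_transpose_apply, Matrix.dotProduct_mulVec, ← Matrix.mulVec_transpose,
      hessianMatrix_transpose, hX, zero_dotProduct]
  have hcol : ∀ i, M i (Fin.last (κ + 2)) = 0 := fun i => by
    rw [hM, mul_mul_transpose_apply, hX, dotProduct_zero]
  have hM' : M.submatrix Fin.castSucc Fin.castSucc =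
      B.submatrix Fin.castSucc id * hessianMatrix P w * (B.submatrix Fin.castSucc id)ᵀ := by
    ext i j
    rw [Matrix.submatrix_apply, hM, mul_mul_transpose_apply, mul_mul_transpose_apply]
    rfl
  have hNll : N (Fin.last (κ + 2)) (Fin.last (κ + 2)) =
      B (Fin.last (κ + 2)) ⬝ᵥ (hessianMatrix π w *ᵥ B (Fin.last (κ + 2))) := by
    rw [hN, mul_mul_transpose_apply]
  rw [← coeff_one_eval_C_comp, eval_C_comp_hessGenMinor_firstOrderDeformation, ← hM, ← hN,
    coeff_one_det_map_C_add_X_smul M N hrow hcol, hM', hNll] at hDw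
  exact hDw

/-- (Zarb), vanishing form: under the same hypotheses, if moreover `π(w) = 0` and
`det(B′·H_P(w)·B′ᵀ) ≠ 0` (e.g. `F′` transverse to the kernel), then `Xᵀ H_π(w) X = 0`.
[cite: LandsbergManivelRessayre2013, §3.3 eq. (Zarb) (p. 477)] -/
theorem hessianQuadratic_eq_zero_of_mem_lmrZariskiTangent {κ d : ℕ} (hd : 3 ≤ d)
    {P π Q : MvPolynomial σ ℂ} (hprime : Prime P) (hP : P.IsHomogeneous d)
    (hπ : π ∈ lmrZariskiTangent κ d P) (B : Matrix (Fin (κ + 3)) σ ℂ)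
    (hQ : hessGenMinor B B P = P * Q) {w : σ → ℂ} (hw : eval w P = 0)
    (hX : hessianMatrix P w *ᵥ B (Fin.last (κ + 2)) = 0)
    (hdet : (B.submatrix Fin.castSucc id * hessianMatrix P w *
      (B.submatrix Fin.castSucc id)ᵀ).det ≠ 0) (hπw : eval w π = 0) :
    B (Fin.last (κ + 2)) ⬝ᵥ (hessianMatrix π w *ᵥ B (Fin.last (κ + 2))) = 0 := by
  have h := det_mul_hessianQuadratic_eq_of_mem_lmrZariskiTangent hd hprime hP hπ B hQ hw hX
  rw [hπw, zero_mul] at h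
  exact (mul_eq_zero.1 h).resolve_left hdet

end Zarb

/-! ### Lemma 3.3.2: the specialisation to `det_n` -/

section DetN

/-- The last row of a frame obtained by appending a row. [folklore] -/
private theorem of_snoc_last {κ : ℕ} {σ : Type*} (B' : Matrix (Fin (κ + 2)) σ ℂ) (X : σ → ℂ) :
    (Matrix.of (Fin.snoc (α := fun _ : Fin (κ + 3) => σ → ℂ) B' X) : Matrix (Fin (κ + 3)) σ ℂ)
      (Fin.last (κ + 2)) = X :=
  Fin.snoc_last (α := fun _ : Fin (κ + 3) => σ → ℂ) (x := X) (p := B')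

/-- The first rows of a frame obtained by appending a row. [folklore] -/
private theorem of_snoc_submatrix_castSucc {κ : ℕ} {σ : Type*} (B' : Matrix (Fin (κ + 2)) σ ℂ)
    (X : σ → ℂ) :
    (Matrix.of (Fin.snoc (α := fun _ : Fin (κ + 3) => σ → ℂ) B' X) : Matrix (Fin (κ + 3)) σ ℂ).submatrix
      Fin.castSucc id = B' := by
  ext i j
  rw [Matrix.submatrix_apply, Matrix.of_apply]
  exact congrFun (Fin.snoc_castSucc (α := fun _ : Fin (κ + 3) => σ → ℂ) (x := X) (p := B') i) j

/-- **LMR 2013, Lemma 3.3.2** (journal p. 478; arXiv `p0007.txt:L18–25`), verbatim: "Suppose that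
`π ∈ S^nW^*` belongs to the affine Zariski tangent space `T̂_{[det_n]} 𝒟ual_{2n−2,n,n²}`. Then for any
matrix `w` of rank `n−1`, and any `X ∈ (H_{det_n,w})_{sing}`, `H_{π,w}(X) = c_{X,w} π(w)`, for some
scalar `c_{X,w}` that does not depend on `π`." Typed with `(H_{det_n,w})_{sing}` = the kernel of the
Hessian matrix of `det_n` at `w` (its description is LMR Lemma 3.3.1,
`hessianMatrix_detPoly_mulVec_eq_zero_iff_of_rank`, `LMR13DetHessianKernel.lean`) and
`H_{π,w}(X) = Xᵀ·H_π(w)·X`; `n ≥ 3` (the scope of the scheme `𝒟ual_{2n−2,n,n²}`, whose equations need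
`d = n ≥ 3`). Proof: `rank H_{det_n,w} = 2n` (`rank_hessianMatrix_detPoly_eq_two_mul_card`), so there
is a `2n`-frame `B′` with `det(B′·H·B′ᵀ) ≠ 0` (`PaddingNotMem.exists_frame_det_ne_zero_of_le_rank`);
with `F = rows(B′) ⊕ ℂX` and `det(B·H_{det}·Bᵀ) = det_n · Q` ((Z0), `det_n` is prime and lies in
`𝒟ual`), (Zarb) gives `c_{X,w} = Q(w) / det(B′·H·B′ᵀ)`.
[cite: LandsbergManivelRessayre2013, Lemma 3.3.2 (p. 478)] -/
theorem exists_hessianQuadratic_eq_mul_eval_of_mem_lmrZariskiTangent_detPoly {n : ℕ} (hn : 3 ≤ n)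
    (Y X : Matrix (Fin n) (Fin n) ℂ) (hY : Y.rank = n - 1)
    (hX : hessianMatrix (detPoly (Fin n) ℂ) (fun p => Y p.1 p.2) *ᵥ (fun p => X p.1 p.2) = 0) :
    ∃ c : ℂ, ∀ π ∈ lmrZariskiTangent (σ := Fin n × Fin n) (2 * n - 2) n (detPoly (Fin n) ℂ),
      (fun p : Fin n × Fin n => X p.1 p.2) ⬝ᵥ
          (hessianMatrix π (fun p => Y p.1 p.2) *ᵥ fun p => X p.1 p.2) =
        c * eval (fun p : Fin n × Fin n => Y p.1 p.2) π := by
  classical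
  haveI : NeZero n := ⟨by omega⟩
  set H := hessianMatrix (detPoly (Fin n) ℂ) (fun p => Y p.1 p.2) with hH
  have hrank : H.rank = 2 * n := by
    have h := rank_hessianMatrix_detPoly_eq_two_mul_card (k := ℂ) (ι := Fin n)
      (by rw [Fintype.card_fin]; omega) Y (by rw [Fintype.card_fin]; exact hY)
    rwa [Fintype.card_fin] at h
  obtain ⟨B', hB'⟩ := PaddingNotMem.exists_frame_det_ne_zero_of_le_rank (s := 2 * n - 2 + 2)
    (H := H) (hessianMatrix_transpose _ _) (by rw [hrank]; omega)
  set B : Matrix (Fin (2 * n - 2 + 3)) (Fin n × Fin n) ℂ :=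
    Matrix.of (Fin.snoc (α := fun _ : Fin (2 * n - 2 + 3) => Fin n × Fin n → ℂ) B'
      (fun p => X p.1 p.2)) with hB
  have hprime : Prime (detPoly (Fin n) ℂ) := detPoly_prime
  have hhom : (detPoly (Fin n) ℂ).IsHomogeneous n := by
    simpa using (detPoly_isHomogeneous (n := Fin n) (k := ℂ))
  obtain ⟨Q, hQ⟩ := dvd_hessGenMinor_of_prime_of_mem_lmrDualScheme hn hprime
    (detPoly_mem_lmrDualScheme hn) B
  refine ⟨eval (fun p : Fin n × Fin n => Y p.1 p.2) Q / (B' * H * B'ᵀ).det, fun π hπ => ?_⟩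
  have hw : eval (fun p : Fin n × Fin n => Y p.1 p.2) (detPoly (Fin n) ℂ) = 0 := by
    rw [eval_detPoly]
    have hYof : (Matrix.of fun i j : Fin n => Y i j) = Y := rfl
    rw [hYof]
    by_contra hdet
    have hu : IsUnit Y := (Matrix.isUnit_iff_isUnit_det Y).mpr (isUnit_iff_ne_zero.mpr hdet)
    have := Matrix.rank_of_isUnit Y hu
    rw [Fintype.card_fin] at this
    omega
  have hXB : hessianMatrix (detPoly (Fin n) ℂ) (fun p => Y p.1 p.2) *ᵥ B (Fin.last (2 * n - 2 + 2)) =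
      0 := by
    rw [hB, of_snoc_last]
    exact hX
  have h := det_mul_hessianQuadratic_eq_of_mem_lmrZariskiTangent hn hprime hhom hπ B hQ hw hXB
  rw [hB, of_snoc_submatrix_castSucc, of_snoc_last, ← hH] at h
  rw [div_mul_eq_mul_div, eq_div_iff hB', mul_comm _ (B' * H * B'ᵀ).det, h, mul_comm]

/-- **Lemma 3.3.2, vanishing form** (the shape used in §3.4, arXiv `p0007.txt:L96–98`: "the
vanishing of `IM_λ(w′,μ)` implies the vanishing of `IM_λ(ζ,w′,μ)`"): for `π ∈ T̂_{[det_n]}`, a matrix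
`w` of rank `n − 1` with `π(w) = 0` and `X` in the kernel of `H_{det_n,w}`, `Xᵀ·H_π(w)·X = 0`.
[cite: LandsbergManivelRessayre2013, Lemma 3.3.2 (p. 478)] -/
theorem hessianQuadratic_eq_zero_of_mem_lmrZariskiTangent_detPoly {n : ℕ} (hn : 3 ≤ n)
    (Y X : Matrix (Fin n) (Fin n) ℂ) (hY : Y.rank = n - 1)
    (hX : hessianMatrix (detPoly (Fin n) ℂ) (fun p => Y p.1 p.2) *ᵥ (fun p => X p.1 p.2) = 0)
    {π : MvPolynomial (Fin n × Fin n) ℂ}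
    (hπ : π ∈ lmrZariskiTangent (σ := Fin n × Fin n) (2 * n - 2) n (detPoly (Fin n) ℂ))
    (hπY : eval (fun p : Fin n × Fin n => Y p.1 p.2) π = 0) :
    (fun p : Fin n × Fin n => X p.1 p.2) ⬝ᵥ
        (hessianMatrix π (fun p => Y p.1 p.2) *ᵥ fun p => X p.1 p.2) = 0 := by
  obtain ⟨c, hc⟩ := exists_hessianQuadratic_eq_mul_eval_of_mem_lmrZariskiTangent_detPoly hn Y X hY hX
  rw [hc π hπ, hπY, mul_zero]

end DetN

end Literature.Computability.AlgebraicComplexity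

end
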